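/-
Copyright (c) 2026 the pub-hodgecm-mathlib formalisation cell (harness21).  Prover seat hodgecm-mathlib-LH5-p05 (g7): (M-Z1♭-RED) (R2) «the rank-one
unitary datum is form-independent», archimedean half — brick (B1″-C′) «SIMILITUDE TRANSPORT OF THE TOP-FORM HAAR MEASURE, SCALARS FROM `E`» (2026-09-02).
-/
import Literature.NumberTheory.Weil1964.UnitaryArchTopFormHaarCongr              -- ★ B1″-C `map_archTopFormHaar_of_conj` and its `e ∕ Φ`-transport lemmas, `conj_mem_archSkew`, `exists_conjLinearMap`
import Literature.NumberTheory.Weil1964.UnitaryArchTopFormHaarCM                 -- ★ B1′ `lieGramDet_ne_zero` (CM situation)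
import Literature.NumberTheory.Automorphic.UnitaryGroupArchProjection            -- ★ `subgroupCongrTop` (equal subgroups are `≃ₜ*`, identity on elements)
import Literature.NumberTheory.Automorphic.UnitaryGroupFormCongrFinSum           -- ★ `formCongr_one_eq`, `formCongr_smul_eq`
import Literature.NumberTheory.Weil1982.UnitaryFinTopFormDensitySimilitudeTransport  -- ★ (Z0-α′) `fin_one_eq_smul`, `fin_one_entry_div_ne_zero` (rank-one algebra)
import HarnessLib

/-!
# The top-form Haar measure of `U(J)(E ⊗ ℝ)` is transported by form SIMILITUDES `σ(T)ᵀ J′ T = (r•J₂)′`, `r ∈ E×`; form-scaling invariance `|Ω_{r•J}| = |Ω_J|`; rank one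
# (Rogawski 1990 §1.7 «compatible measures»; Helgason 2000 Ch. I §1 Thm. 1.14; Macdonald 1980)

Topic `NumberTheory/Weil1964`; namespace `Literature.NumberTheory.Weil1964.UnitaryArchTopForm` (continues ★ B1 `UnitaryArchTopFormHaar`, ★ B1″ parts A–C).  THEOREMS ONLY (no
definition, no instance, no notation, no named fact, no `sorry`); kernel lane `--kind proof --supports stmt-HodgeConjecture-24833`.  Cell `pub/hodgecm-mathlib`, crux H413 =
`stmt-HodgeConjecture-24833`, half A line LH5 (closer stub `stub_S1finTFCovol`), third layer LH5c organ Z1♭ `stub_blockModelCovolEq`; memo (M-Z1♭-RED) v1 (LH5-p02 (g6)) §1 (R2)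
«the `U(1)` block is literal» ∕ census (R3) (LH5-p04 (g6)) §2 «Z1♭♭_b»: the ARCHIMEDEAN letter (finite-place letter = ★ (Z0-α′) `tamagawaDensity_rankOne_eq`).
HONEST LABEL: count-neutral transport lemma; Z1♭ stays PRINT ([Kottwitz1988 Thm. 1, Prop. 2] = Eichler–Weil `τ(SL₁(D)) = 1`); HC_CM is proved only modulo the 7 printed
citations (2 remaining: hLiu418 = `stmt-HodgeConjecture-24832`, h413 = `stmt-HodgeConjecture-24833`) until rung 0 closes.

THE MATHEMATICS.  ★ B1″-C `map_archTopFormHaar_of_conj` transports `archTopFormHaar` (= `2^{−d}|Ω_J|`, the Haar measure whose Cayley-window germ is the trace-form Lebesgue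
measure `lieStdLebesgue` on `𝔲(J)`) along a form CONGRUENCE `σ(T)ᵀ J′ T = J₂′`.  A form SIMILITUDE `σ(T)ᵀ J′ T = (r • J₂)′`, `r ∈ E×`, is not a congruence when `r` is
not a norm (e.g. `J₂ = (1)`, `J = (−1)` at a complex place: the groups `U(1)` coincide, the forms are not congruent), but it transports everything the measure is made of:
the Lie algebra `𝔲(r • J₂) = 𝔲(J₂)` (`archSkew_smul`: the skew condition `X^* J′ + J′ X = 0` is blind to a unit scalar), the group `U(r • J₂) = U(J₂)` (`arch_smul`, ★
`unitaryGroupOfForm_smul_of_isUnit`), while the trace form, the Cayley chart and its Jacobian weight never read the form.  So `Ad T : 𝔲(J₂) ≃L[ℝ] 𝔲(J)` still exists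
(`exists_conjEquiv_of_simil`, from ★ `conj_mem_archSkew` at the form `r • J₂` and `archSkew_smul`), and ★ B1″-C's proof runs VERBATIM on it (its `e ∕ Φ`-lemmas
`lieGramDet_ne_zero_iff_of_conj`, `conj_mem_cayleySource`, `image_cayleyChart_image_conjEquiv`, `map_conj_cayleyChartMeasure`, `eq_archTopFormHaar_of_restrict_eq` take only
`e`, `Φ`): **`map_archTopFormHaar_of_simil`**.  At `T = 1` the similitude is the form scaling `J ↦ r • J` and `Φ` is the identity of `GL_N(E ⊗ ℝ)` read between the equal
subgroups (★ `subgroupCongrTop`): **`map_subgroupCongrTop_archTopFormHaar_smul`** (`|Ω_{r•J}|` IS `|Ω_J|`), hypothesis-free in the CM situation for `r ∈ F×`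
(`…_of_isCM`).  Rank one: two `1 × 1` forms with non-zero entry are proportional (★ `fin_one_eq_smul`), so `U(Hb) = U(Hb′) = {x : x̄x = 1}` carry the SAME top-form measure
(**`map_subgroupCongrTop_archTopFormHaar_rankOne`**, `…_of_isCM`) — the archimedean letter of «the `U(1)` block of Z1♭'s block model is form-independent».

* §1 `archFormOf_smul`, `isUnit_mixedEmbedding`, **`archSkew_smul`**, **`arch_smul`**, `formCongr_archFormOf_inv_of_simil`, `conj_mem_archSkew_of_simil`, `exists_conjLinearMap_of_simil`,
  **`exists_conjEquiv_of_simil`**, `lieGramDet_ne_zero_iff_of_simil`.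
* §2 **`map_archTopFormHaar_of_simil`**.
* §3 `coe_subgroupCongrTop_arch_smul_symm`, `lieGramDet_smul_ne_zero_iff`, **`map_subgroupCongrTop_archTopFormHaar_smul`**, `map_subgroupCongrTop_archTopFormHaar_smul_of_isCM`.
* §4 `arch_rankOne_eq`, `formCongr_one_archFormOf_rankOne`, **`map_subgroupCongrTop_archTopFormHaar_rankOne`**, `map_subgroupCongrTop_archTopFormHaar_rankOne_of_isCM`.

## References
* J. D. Rogawski, *Automorphic Representations of Unitary Groups in Three Variables*, Ann. of Math. Stud. 123 (1990), §1.7 p. 6 («compatible measures `dg = |Ω|_v`»). [Rogawski1990]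
* S. Helgason, *Groups and Geometric Analysis*, AMS Math. Surveys Monogr. 83 (2000), Ch. I §1 Thm. 1.14 p. 96 (Haar measure in a chart). [Helgason2000]
* I. G. Macdonald, *The volume of a compact Lie group*, Invent. Math. 56 (1980), 93–95 (the trace-form normalisation). [Macdonald1980]
* V. Platonov, A. Rapinchuk, *Algebraic Groups and Number Theory* (1994), §2.3 (similar forms have the same unitary group). [PlatonovRapinchuk1994]
-/

set_option autoImplicit false
-- the scoped normed structure on the submodule `𝔲 ≤ M_N(E ⊗ ℝ)` vs the `[BorelSpace ↥(archSkew …)]` binder's subtype topology (as in ★ B1 ∕ ★ B1″ ∕ ★ B5b)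
set_option backward.isDefEq.respectTransparency false

noncomputable section

open NumberField NumberField.mixedEmbedding NumberField.InfinitePlace Set Filter Topology MeasureTheory MeasureTheory.Measure
open Literature.NumberTheory.Automorphic Literature.NumberTheory.Automorphic.UnitaryGroup
open scoped Classical Matrix Matrix.Norms.Operator MatrixGroups ENNReal NNReal Pointwise

namespace Literature.NumberTheory.Weil1964

namespace UnitaryArchTopForm

/-! ## §1 Form scaling on the archimedean side: `(r•J)′ = r′•J′`, `𝔲(r•J) = 𝔲(J)`, `U(r•J) = U(J)`, and `Ad T` along a similitude -/

section Simil

variable (F E : Type) [Field F] [Field E] [NumberField E] [Algebra F E] (c : E ≃ₐ[F] E) (N : ℕ) (J J₂ : Matrix (Fin N) (Fin N) E)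

variable {F E c N J J₂}

omit [NumberField E] in
/-- `(r • J) ⊗ 1 = (r ⊗ 1) • (J ⊗ 1)` in `M_N(E ⊗ ℝ)`. [cite: PlatonovRapinchuk1994, §2.3] -/
theorem archFormOf_smul (r : E) (J : Matrix (Fin N) (Fin N) E) : archFormOf E N (r • J) = mixedEmbedding E r • archFormOf E N J := by
  funext i j
  simp only [archFormOf, Matrix.map_apply, Matrix.smul_apply, smul_eq_mul, map_mul]

omit [NumberField E] in
/-- A non-zero `r ∈ E` is a unit of `E ⊗ ℝ`. [cite: PlatonovRapinchuk1994, §2.3] -/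
theorem isUnit_mixedEmbedding {r : E} (hr : r ≠ 0) : IsUnit (mixedEmbedding E r) :=
  (IsUnit.mk0 r hr).map _

omit [NumberField E] in
/-- **`𝔲(r • J) = 𝔲(J)`** for `r ∈ E×`: the skew condition `X^* J′ + J′ X = 0` is invariant under a unit scalar on the form. [cite: PlatonovRapinchuk1994, §2.3] [cite: Knapp2002, I §1] -/
theorem archSkew_smul {r : E} (hr : r ≠ 0) (J : Matrix (Fin N) (Fin N) E) : archSkew F E c N (r • J) = archSkew F E c N J := by
  obtain ⟨u, hu⟩ := isUnit_mixedEmbedding (E := E) hr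
  ext X
  rw [mem_archSkew_iff, mem_archSkew_iff, archFormOf_smul, ← hu, Matrix.mul_smul, Matrix.smul_mul, ← smul_add]
  constructor
  · intro h
    have h' := congrArg (fun M => ((u⁻¹ : (mixedSpace E)ˣ) : mixedSpace E) • M) h
    simpa only [smul_smul, Units.inv_mul, one_smul, smul_zero] using h'
  · intro h
    rw [h, smul_zero]

omit [NumberField E] in
/-- **`U(r • J)(E ⊗ ℝ) = U(J)(E ⊗ ℝ)`** for `r ∈ E×` (archimedean twin of ★ `adelic_smul` ∕ `finAdelic_smul` ∕ `local_smul`). [cite: PlatonovRapinchuk1994, §2.3] -/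
theorem arch_smul {r : E} (hr : r ≠ 0) (J : Matrix (Fin N) (Fin N) E) : arch F E c N (r • J) = arch F E c N J := by
  change unitaryGroupOfForm _ (archFormOf E N (r • J)) = unitaryGroupOfForm _ (archFormOf E N J)
  rw [archFormOf_smul]
  exact unitaryGroupOfForm_smul_of_isUnit _ (isUnit_mixedEmbedding hr) _

omit [NumberField E] in
/-- The inverse similitude: `σ(T)ᵀ J′ T = (r • J₂)′` gives `σ(T⁻¹)ᵀ J₂′ T⁻¹ = (r⁻¹ • J)′`. [cite: PlatonovRapinchuk1994, §2.3] -/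
theorem formCongr_archFormOf_inv_of_simil {T : GL (Fin N) (mixedSpace E)} {r : E} (hr : r ≠ 0)
    (h : formCongr (conjMixed F E c) T (archFormOf E N J) = archFormOf E N (r • J₂)) :
    formCongr (conjMixed F E c) T⁻¹ (archFormOf E N J₂) = archFormOf E N (r⁻¹ • J) := by
  obtain ⟨u, hu⟩ := isUnit_mixedEmbedding (E := E) hr
  have hinv : mixedEmbedding E r⁻¹ = ((u⁻¹ : (mixedSpace E)ˣ) : mixedSpace E) :=
    (Units.inv_eq_of_mul_eq_one_left (by rw [hu, ← map_mul, inv_mul_cancel₀ hr, map_one])).symm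
  have key : formCongr (conjMixed F E c) T⁻¹ (archFormOf E N (r • J₂)) = archFormOf E N J := by rw [← h, formCongr_inv_formCongr]
  rw [archFormOf_smul, formCongr_smul_eq, ← hu] at key
  rw [archFormOf_smul, hinv, ← key, smul_smul, Units.inv_mul, one_smul]

omit [NumberField E] in
/-- **A similitude conjugates the Lie algebras**: `σ(T)ᵀ J′ T = (r • J₂)′`, `X ∈ 𝔲(J₂)` ⇒ `T X T⁻¹ ∈ 𝔲(J)` (★ `conj_mem_archSkew` at the form `r • J₂`, read through `archSkew_smul`).
[cite: Knapp2002, I §1] [cite: Rogawski1990, §1.7 p. 6] -/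
theorem conj_mem_archSkew_of_simil {T : GL (Fin N) (mixedSpace E)} {r : E} (hr : r ≠ 0)
    (h : formCongr (conjMixed F E c) T (archFormOf E N J) = archFormOf E N (r • J₂))
    {X : Matrix (Fin N) (Fin N) (mixedSpace E)} (hX : X ∈ archSkew F E c N J₂) :
    (T : Matrix (Fin N) (Fin N) (mixedSpace E)) * X * ((T⁻¹ : GL (Fin N) (mixedSpace E)) : Matrix (Fin N) (Fin N) (mixedSpace E)) ∈ archSkew F E c N J :=
  conj_mem_archSkew h ((archSkew_smul (F := F) (c := c) hr J₂).symm ▸ hX)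

omit [NumberField E] in
/-- `Ad T` as an `ℝ`-linear map `𝔲(J₂) → 𝔲(J)` along a similitude. [cite: Knapp2002, I §1] [cite: Rogawski1990, §1.7 p. 6] -/
theorem exists_conjLinearMap_of_simil {T : GL (Fin N) (mixedSpace E)} {r : E} (hr : r ≠ 0)
    (h : formCongr (conjMixed F E c) T (archFormOf E N J) = archFormOf E N (r • J₂)) :
    ∃ f : archSkew F E c N J₂ →ₗ[ℝ] archSkew F E c N J, ∀ X : archSkew F E c N J₂,
      ((f X : archSkew F E c N J) : Matrix (Fin N) (Fin N) (mixedSpace E)) =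
        (T : Matrix (Fin N) (Fin N) (mixedSpace E)) * (X : Matrix (Fin N) (Fin N) (mixedSpace E)) *
          ((T⁻¹ : GL (Fin N) (mixedSpace E)) : Matrix (Fin N) (Fin N) (mixedSpace E)) :=
  ⟨((LinearMap.mulLeftRight ℝ ((T : Matrix (Fin N) (Fin N) (mixedSpace E)),
        ((T⁻¹ : GL (Fin N) (mixedSpace E)) : Matrix (Fin N) (Fin N) (mixedSpace E)))).comp (archSkew F E c N J₂).subtype).codRestrict
      (archSkew F E c N J) fun X => conj_mem_archSkew_of_simil hr h X.2,
    fun _ => rfl⟩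

/-- **`Ad T : 𝔲(J₂) ≃L[ℝ] 𝔲(J)` ALONG A SIMILITUDE** `σ(T)ᵀ J′ T = (r • J₂)′`, `r ∈ E×`: a continuous linear isomorphism `e` with `e X = T X T⁻¹` (inverse `Ad T⁻¹`, along the
inverse similitude `formCongr_archFormOf_inv_of_simil`). [cite: Knapp2002, I §1] [cite: Rogawski1990, §1.7 p. 6] -/
theorem exists_conjEquiv_of_simil {T : GL (Fin N) (mixedSpace E)} {r : E} (hr : r ≠ 0)
    (h : formCongr (conjMixed F E c) T (archFormOf E N J) = archFormOf E N (r • J₂)) :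
    ∃ e : archSkew F E c N J₂ ≃L[ℝ] archSkew F E c N J, ∀ X : archSkew F E c N J₂,
      ((e X : archSkew F E c N J) : Matrix (Fin N) (Fin N) (mixedSpace E)) =
        (T : Matrix (Fin N) (Fin N) (mixedSpace E)) * (X : Matrix (Fin N) (Fin N) (mixedSpace E)) *
          ((T⁻¹ : GL (Fin N) (mixedSpace E)) : Matrix (Fin N) (Fin N) (mixedSpace E)) := by
  haveI : FiniteDimensional ℝ (Matrix (Fin N) (Fin N) (mixedSpace E)) := finiteDimensional_matrix
  have h' := formCongr_archFormOf_inv_of_simil (J := J) (J₂ := J₂) hr h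
  obtain ⟨f, hf⟩ := exists_conjLinearMap_of_simil (J := J) (J₂ := J₂) hr h
  obtain ⟨g, hg⟩ := exists_conjLinearMap_of_simil (J := J₂) (J₂ := J) (inv_ne_zero hr) h'
  simp only [inv_inv] at hg
  have hTT : (T : Matrix (Fin N) (Fin N) (mixedSpace E)) * ((T⁻¹ : GL (Fin N) (mixedSpace E)) : Matrix (Fin N) (Fin N) (mixedSpace E)) = 1 := by
    rw [← Units.val_mul, mul_inv_cancel, Units.val_one]
  have hTT' : ((T⁻¹ : GL (Fin N) (mixedSpace E)) : Matrix (Fin N) (Fin N) (mixedSpace E)) * (T : Matrix (Fin N) (Fin N) (mixedSpace E)) = 1 := by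
    rw [← Units.val_mul, inv_mul_cancel, Units.val_one]
  have h₁ : f ∘ₗ g = LinearMap.id := by
    apply LinearMap.ext
    intro Y
    apply Subtype.ext
    rw [LinearMap.comp_apply, hf, hg, LinearMap.id_apply]
    simp only [Matrix.mul_assoc, hTT, Matrix.mul_one]
    rw [← Matrix.mul_assoc, hTT, Matrix.one_mul]
  have h₂ : g ∘ₗ f = LinearMap.id := by
    apply LinearMap.ext
    intro X
    apply Subtype.ext
    rw [LinearMap.comp_apply, hg, hf, LinearMap.id_apply]
    simp only [Matrix.mul_assoc, hTT', Matrix.mul_one]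
    rw [← Matrix.mul_assoc, hTT', Matrix.one_mul]
  exact ⟨(LinearEquiv.ofLinear f g h₁ h₂).toContinuousLinearEquiv, fun X => hf X⟩

/-- Non-degeneracy of the trace form on `𝔲` is invariant under a similitude: `lieGramDet J ≠ 0 ↔ lieGramDet J₂ ≠ 0`. [cite: Macdonald1980, p. 93] -/
theorem lieGramDet_ne_zero_iff_of_simil {T : GL (Fin N) (mixedSpace E)} {r : E} (hr : r ≠ 0)
    (h : formCongr (conjMixed F E c) T (archFormOf E N J) = archFormOf E N (r • J₂)) :
    lieGramDet F E c N J ≠ 0 ↔ lieGramDet F E c N J₂ ≠ 0 := by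
  obtain ⟨e, he⟩ := exists_conjEquiv_of_simil (J := J) (J₂ := J₂) hr h
  exact lieGramDet_ne_zero_iff_of_conj e he

end Simil

/-! ## §2 The similitude transport of `archTopFormHaar` -/

section Transport

variable {F E : Type} [Field F] [Field E] [NumberField E] [Algebra F E] {c : E ≃ₐ[F] E} {N : ℕ} {J J₂ : Matrix (Fin N) (Fin N) E}

variable [MeasurableSpace (archSkew F E c N J)] [BorelSpace (archSkew F E c N J)] [MeasurableSpace (arch F E c N J)] [BorelSpace (arch F E c N J)]
variable [MeasurableSpace (archSkew F E c N J₂)] [BorelSpace (archSkew F E c N J₂)] [MeasurableSpace (arch F E c N J₂)] [BorelSpace (arch F E c N J₂)]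

/-- **SIMILITUDE TRANSPORT OF THE TOP-FORM HAAR MEASURE.**  Let `σ(T)ᵀ J′ T = (r • J₂)′` with `r ∈ E×` and let `Φ : U(J₂)(E ⊗ ℝ) ≃ₜ* U(J)(E ⊗ ℝ)` act by `g ↦ T g T⁻¹`
(`U(r • J₂) = U(J₂)`).  Then `Φ_* archTopFormHaar J₂ = archTopFormHaar J` (the trace form on `𝔲(J)` non-degenerate) — ★ B1″-C `map_archTopFormHaar_of_conj` is the case `r = 1`;
proof = its proof verbatim on the similitude's `Ad T` (`exists_conjEquiv_of_simil`): `Φ_* archTopFormHaar J₂` is a Haar measure satisfying the window identity on the transported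
window `e(V₀)`, hence equals `archTopFormHaar J` by ★ `eq_archTopFormHaar_of_restrict_eq`. [cite: Rogawski1990, §1.7 p. 6] [cite: Helgason2000, Ch. I §1 Thm. 1.14 p. 96] [cite: Macdonald1980, p. 93] -/
theorem map_archTopFormHaar_of_simil (hnd : lieGramDet F E c N J ≠ 0) {T : GL (Fin N) (mixedSpace E)} {r : E} (hr : r ≠ 0)
    (h : formCongr (conjMixed F E c) T (archFormOf E N J) = archFormOf E N (r • J₂)) (Φ : arch F E c N J₂ ≃ₜ* arch F E c N J)
    (hΦ : ∀ g : arch F E c N J₂, ((Φ g : arch F E c N J) : GL (Fin N) (mixedSpace E)) = T * (g : GL (Fin N) (mixedSpace E)) * T⁻¹) :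
    Measure.map Φ (archTopFormHaar F E c N J₂) = archTopFormHaar F E c N J := by
  haveI : FiniteDimensional ℝ (Matrix (Fin N) (Fin N) (mixedSpace E)) := finiteDimensional_matrix
  obtain ⟨e, he⟩ := exists_conjEquiv_of_simil (J := J) (J₂ := J₂) hr h
  have hnd₂ : lieGramDet F E c N J₂ ≠ 0 := (lieGramDet_ne_zero_iff_of_conj e he).1 hnd
  haveI := isHaarMeasure_archTopFormHaar J₂ hnd₂
  haveI : (Measure.map Φ (archTopFormHaar F E c N J₂)).IsHaarMeasure := ContinuousMulEquiv.isHaarMeasure_map _ Φ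
  -- the transported window
  have hVo : IsOpen (e '' window F E c N J₂) := e.toHomeomorph.isOpenMap _ (isOpen_window J₂)
  have h0 : (0 : archSkew F E c N J) ∈ e '' window F E c N J₂ := ⟨0, zero_mem_window J₂, map_zero e⟩
  have hVs : e '' window F E c N J₂ ⊆ cayleySource F E c N J := by
    rintro _ ⟨X, hX, rfl⟩
    exact conj_mem_cayleySource e he (window_subset_cayleySource J₂ hX)
  refine eq_archTopFormHaar_of_restrict_eq J hnd _ hVo h0 hVs ?_
  -- the window identity on `ĉ_J(e(V₀)) = Φ(ĉ_{J₂}(V₀))`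
  set Φm : arch F E c N J₂ ≃ᵐ arch F E c N J := Φ.toHomeomorph.toMeasurableEquiv with hΦm_def
  have hΦm : (⇑Φm : arch F E c N J₂ → arch F E c N J) = ⇑Φ := rfl
  have hpre : ⇑Φm ⁻¹' (⇑Φm '' (cayleyChart F E c N J₂ '' window F E c N J₂)) = cayleyChart F E c N J₂ '' window F E c N J₂ :=
    Φm.injective.preimage_image _
  rw [image_cayleyChart_image_conjEquiv Φ hΦ e he (window_subset_cayleySource J₂), ← hΦm, Φm.restrict_map, hpre, archTopFormHaar_restrict_window J₂ hnd₂, hΦm]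
  exact map_conj_cayleyChartMeasure Φ hΦ e he (window_subset_cayleySource J₂) (isOpen_window J₂).measurableSet

end Transport

/-! ## §3 Form scaling `J ↦ r • J`: the identity of `GL_N(E ⊗ ℝ)` carries `|Ω_J|` to `|Ω_{r•J}|` -/

section Scaling

variable {F E : Type} [Field F] [Field E] [NumberField E] [Algebra F E] {c : E ≃ₐ[F] E} {N : ℕ} (J : Matrix (Fin N) (Fin N) E) {r : E} (hr : r ≠ 0)

variable [MeasurableSpace (archSkew F E c N J)] [BorelSpace (archSkew F E c N J)] [MeasurableSpace (arch F E c N J)] [BorelSpace (arch F E c N J)]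
variable [MeasurableSpace (archSkew F E c N (r • J))] [BorelSpace (archSkew F E c N (r • J))] [MeasurableSpace (arch F E c N (r • J))] [BorelSpace (arch F E c N (r • J))]

omit [NumberField E] [MeasurableSpace (archSkew F E c N J)] [BorelSpace (archSkew F E c N J)] [MeasurableSpace (arch F E c N J)] [BorelSpace (arch F E c N J)]
  [MeasurableSpace (archSkew F E c N (r • J))] [BorelSpace (archSkew F E c N (r • J))] [MeasurableSpace (arch F E c N (r • J))] [BorelSpace (arch F E c N (r • J))] in
/-- The scaling identification `U(J)(E ⊗ ℝ) ≃ₜ* U(r • J)(E ⊗ ℝ)` (★ `subgroupCongrTop` on `arch_smul`) is the identity on `GL_N(E ⊗ ℝ)`, i.e. acts by `g ↦ 1·g·1⁻¹`.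
[cite: PlatonovRapinchuk1994, §2.3] -/
theorem coe_subgroupCongrTop_arch_smul_symm (g : arch F E c N J) :
    (((subgroupCongrTop (arch_smul (F := F) (c := c) hr J)).symm g : arch F E c N (r • J)) : GL (Fin N) (mixedSpace E)) =
      1 * (g : GL (Fin N) (mixedSpace E)) * 1⁻¹ := by
  rw [coe_subgroupCongrTop_symm_apply, inv_one, one_mul, mul_one]

omit [MeasurableSpace (archSkew F E c N J)] [BorelSpace (archSkew F E c N J)] [MeasurableSpace (arch F E c N J)] [BorelSpace (arch F E c N J)]
  [MeasurableSpace (archSkew F E c N (r • J))] [BorelSpace (archSkew F E c N (r • J))] [MeasurableSpace (arch F E c N (r • J))] [BorelSpace (arch F E c N (r • J))] in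
include hr in
/-- Non-degeneracy of the trace form on `𝔲` is invariant under form scaling: `lieGramDet (r • J) ≠ 0 ↔ lieGramDet J ≠ 0`. [cite: Macdonald1980, p. 93] -/
theorem lieGramDet_smul_ne_zero_iff : lieGramDet F E c N (r • J) ≠ 0 ↔ lieGramDet F E c N J ≠ 0 :=
  lieGramDet_ne_zero_iff_of_simil (J := r • J) (J₂ := J) (T := 1) hr (formCongr_one_eq _ _)

/-- **FORM-SCALING INVARIANCE OF THE TOP-FORM HAAR MEASURE: `|Ω_{r•J}| = |Ω_J|`** — the identity of `GL_N(E ⊗ ℝ)`, read as `U(J)(E ⊗ ℝ) ≃ₜ* U(r • J)(E ⊗ ℝ)` (★ `subgroupCongrTop`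
on `arch_smul`), carries `archTopFormHaar J` to `archTopFormHaar (r • J)` for `r ∈ E×` (the trace form on `𝔲(J)` non-degenerate): §2 at the similitude `(T, r) = (1, r)`.
[cite: Rogawski1990, §1.7 p. 6] [cite: Helgason2000, Ch. I §1 Thm. 1.14 p. 96] [cite: PlatonovRapinchuk1994, §2.3] -/
theorem map_subgroupCongrTop_archTopFormHaar_smul (hnd : lieGramDet F E c N J ≠ 0) :
    Measure.map (α := arch F E c N J) (β := arch F E c N (r • J)) (subgroupCongrTop (arch_smul (F := F) (c := c) hr J)).symm (archTopFormHaar F E c N J) =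
      archTopFormHaar F E c N (r • J) :=
  map_archTopFormHaar_of_simil (J := r • J) (J₂ := J) ((lieGramDet_smul_ne_zero_iff J hr).2 hnd) (T := 1) hr (formCongr_one_eq _ _) _
    (coe_subgroupCongrTop_arch_smul_symm J hr)

/-- The CM situation (`c ≠ 1` fixing every infinite place, `J` `c`-hermitian with `det J` a unit): `|Ω_{r•J}| = |Ω_J|` along the identity with no hypothesis left
(★ B1′ `lieGramDet_ne_zero`). [cite: Rogawski1990, §1.7 p. 6] -/
theorem map_subgroupCongrTop_archTopFormHaar_smul_of_isCM (hc : c ≠ 1) (hfix : ∀ w : InfinitePlace E, c • w = w) (hherm : (J.map c)ᵀ = J) (hJ : IsUnit J.det) :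
    Measure.map (α := arch F E c N J) (β := arch F E c N (r • J)) (subgroupCongrTop (arch_smul (F := F) (c := c) hr J)).symm (archTopFormHaar F E c N J) =
      archTopFormHaar F E c N (r • J) :=
  map_subgroupCongrTop_archTopFormHaar_smul J hr (lieGramDet_ne_zero J hc hfix hherm hJ)

end Scaling

/-! ## §4 Rank one over a CM field: `U(Hb) = U(Hb′) = {x : x̄x = 1}` carry the same top-form measure -/

section RankOne

variable (L : Type) [Field L] [NumberField L] [IsCMField L] (Hb Hb' : Matrix (Fin 1) (Fin 1) L) (h : Hb 0 0 ≠ 0) (h' : Hb' 0 0 ≠ 0)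

variable [MeasurableSpace (archSkew (↥(maximalRealSubfield L)) L (IsCMField.complexConj L) 1 Hb)] [BorelSpace (archSkew (↥(maximalRealSubfield L)) L (IsCMField.complexConj L) 1 Hb)]
  [MeasurableSpace (arch (↥(maximalRealSubfield L)) L (IsCMField.complexConj L) 1 Hb)] [BorelSpace (arch (↥(maximalRealSubfield L)) L (IsCMField.complexConj L) 1 Hb)]
  [MeasurableSpace (archSkew (↥(maximalRealSubfield L)) L (IsCMField.complexConj L) 1 Hb')] [BorelSpace (archSkew (↥(maximalRealSubfield L)) L (IsCMField.complexConj L) 1 Hb')]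
  [MeasurableSpace (arch (↥(maximalRealSubfield L)) L (IsCMField.complexConj L) 1 Hb')] [BorelSpace (arch (↥(maximalRealSubfield L)) L (IsCMField.complexConj L) 1 Hb')]

omit [MeasurableSpace (archSkew (↥(maximalRealSubfield L)) L (IsCMField.complexConj L) 1 Hb)] [BorelSpace (archSkew (↥(maximalRealSubfield L)) L (IsCMField.complexConj L) 1 Hb)]
  [MeasurableSpace (arch (↥(maximalRealSubfield L)) L (IsCMField.complexConj L) 1 Hb)] [BorelSpace (arch (↥(maximalRealSubfield L)) L (IsCMField.complexConj L) 1 Hb)]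
  [MeasurableSpace (archSkew (↥(maximalRealSubfield L)) L (IsCMField.complexConj L) 1 Hb')] [BorelSpace (archSkew (↥(maximalRealSubfield L)) L (IsCMField.complexConj L) 1 Hb')]
  [MeasurableSpace (arch (↥(maximalRealSubfield L)) L (IsCMField.complexConj L) 1 Hb')] [BorelSpace (arch (↥(maximalRealSubfield L)) L (IsCMField.complexConj L) 1 Hb')] in
include h in
/-- **`U(Hb′)(L ⊗ ℝ) = U(Hb)(L ⊗ ℝ)`** for two `1 × 1` forms, the first with non-zero entry (`Hb′ = (Hb′₀₀ Hb₀₀⁻¹) • Hb`, ★ `fin_one_eq_smul`, then `arch_smul`; if `Hb′₀₀ = 0` both sides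
need not agree, so the second entry is required non-zero too). [cite: PlatonovRapinchuk1994, §2.3] -/
theorem arch_rankOne_eq (h' : Hb' 0 0 ≠ 0) :
    arch (↥(maximalRealSubfield L)) L (IsCMField.complexConj L) 1 Hb' = arch (↥(maximalRealSubfield L)) L (IsCMField.complexConj L) 1 Hb := by
  rw [Literature.NumberTheory.Weil1982.UnitaryFinTopForm.fin_one_eq_smul L Hb Hb' h]
  exact arch_smul (Literature.NumberTheory.Weil1982.UnitaryFinTopForm.fin_one_entry_div_ne_zero L Hb Hb' h h') Hb

omit [MeasurableSpace (archSkew (↥(maximalRealSubfield L)) L (IsCMField.complexConj L) 1 Hb)] [BorelSpace (archSkew (↥(maximalRealSubfield L)) L (IsCMField.complexConj L) 1 Hb)]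
  [MeasurableSpace (arch (↥(maximalRealSubfield L)) L (IsCMField.complexConj L) 1 Hb)] [BorelSpace (arch (↥(maximalRealSubfield L)) L (IsCMField.complexConj L) 1 Hb)]
  [MeasurableSpace (archSkew (↥(maximalRealSubfield L)) L (IsCMField.complexConj L) 1 Hb')] [BorelSpace (archSkew (↥(maximalRealSubfield L)) L (IsCMField.complexConj L) 1 Hb')]
  [MeasurableSpace (arch (↥(maximalRealSubfield L)) L (IsCMField.complexConj L) 1 Hb')] [BorelSpace (arch (↥(maximalRealSubfield L)) L (IsCMField.complexConj L) 1 Hb')] in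
include h in
/-- The identity frame is an archimedean similitude between two rank-one forms: `σ(1)ᵀ Hb′′ 1 = ((Hb′₀₀ Hb₀₀⁻¹) • Hb)′`. [cite: PlatonovRapinchuk1994, §2.3] -/
theorem formCongr_one_archFormOf_rankOne :
    formCongr (conjMixed (↥(maximalRealSubfield L)) L (IsCMField.complexConj L)) (1 : GL (Fin 1) (mixedSpace L)) (archFormOf L 1 Hb') =
      archFormOf L 1 ((Hb' 0 0 * (Hb 0 0)⁻¹) • Hb) := by
  rw [formCongr_one_eq, ← Literature.NumberTheory.Weil1982.UnitaryFinTopForm.fin_one_eq_smul L Hb Hb' h]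

/-- **RANK ONE: `U(Hb)(L ⊗ ℝ)` AND `U(Hb′)(L ⊗ ℝ)` CARRY THE SAME TOP-FORM HAAR MEASURE** along the identity of `GL₁(L ⊗ ℝ)` (★ `subgroupCongrTop` on `arch_rankOne_eq`), for any two
`1 × 1` forms with non-zero entry (the trace form on `𝔲(Hb′)` non-degenerate) — the archimedean letter of «the `U(1)` block of Z1♭'s block model is form-independent» (memo
(M-Z1♭-RED) (R2)); §2 at the similitude `(T, r) = (1, Hb′₀₀ Hb₀₀⁻¹)`. [cite: Rogawski1990, §1.7 p. 6] [cite: Helgason2000, Ch. I §1 Thm. 1.14 p. 96] [cite: PlatonovRapinchuk1994, §2.3] -/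
theorem map_subgroupCongrTop_archTopFormHaar_rankOne (hnd : lieGramDet (↥(maximalRealSubfield L)) L (IsCMField.complexConj L) 1 Hb' ≠ 0) :
    Measure.map (α := arch (↥(maximalRealSubfield L)) L (IsCMField.complexConj L) 1 Hb) (β := arch (↥(maximalRealSubfield L)) L (IsCMField.complexConj L) 1 Hb')
        (subgroupCongrTop (arch_rankOne_eq L Hb Hb' h h')).symm (archTopFormHaar (↥(maximalRealSubfield L)) L (IsCMField.complexConj L) 1 Hb) =
      archTopFormHaar (↥(maximalRealSubfield L)) L (IsCMField.complexConj L) 1 Hb' :=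
  map_archTopFormHaar_of_simil (J := Hb') (J₂ := Hb) hnd (T := 1) (Literature.NumberTheory.Weil1982.UnitaryFinTopForm.fin_one_entry_div_ne_zero L Hb Hb' h h') (formCongr_one_archFormOf_rankOne L Hb Hb' h) _
    fun g => by rw [coe_subgroupCongrTop_symm_apply, inv_one, one_mul, mul_one]

/-- The CM situation, no hypothesis on the trace form: `Hb′` hermitian (`c(Hb′₀₀) = Hb′₀₀` entrywise) with unit determinant. [cite: Rogawski1990, §1.7 p. 6] -/
theorem map_subgroupCongrTop_archTopFormHaar_rankOne_of_isCM (hherm : (Hb'.map (IsCMField.complexConj L))ᵀ = Hb') (hdet : IsUnit Hb'.det) :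
    Measure.map (α := arch (↥(maximalRealSubfield L)) L (IsCMField.complexConj L) 1 Hb) (β := arch (↥(maximalRealSubfield L)) L (IsCMField.complexConj L) 1 Hb')
        (subgroupCongrTop (arch_rankOne_eq L Hb Hb' h h')).symm (archTopFormHaar (↥(maximalRealSubfield L)) L (IsCMField.complexConj L) 1 Hb) =
      archTopFormHaar (↥(maximalRealSubfield L)) L (IsCMField.complexConj L) 1 Hb' :=
  map_subgroupCongrTop_archTopFormHaar_rankOne L Hb Hb' h h'
    (lieGramDet_ne_zero Hb' (IsCMField.complexConj_ne_one L) (complexConj_smul_infinitePlace L) hherm hdet)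

end RankOne

end UnitaryArchTopForm

end Literature.NumberTheory.Weil1964

end
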